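import Literature.MathematicalPhysics.QuantumFieldTheory.Balaban1983to89.B9Eq3126H1kPiSupRowClosed
import Literature.MathematicalPhysics.QuantumFieldTheory.Balaban1983to89.B9Eq3130GtildeGradRowClosed

/-!
# `Balaban1983to89.B9Eq3126H1kPiSliceGradRowClosed` — T. Bałaban, *Propagators for lattice gauge theories in a background field*, Commun. Math. Phys. **99** (1985)
# 389–434 [Balaban1985BackgroundPropagators] (3.126) p. 420 (*«HB = GQ\*(QGQ\*)⁻¹B»*), (3.132)–(3.133) p. 422 (the rows of `H` for the operator `G` of
# (3.130)), (3.3) p. 391, Thm 3.3 p. 399 (the GRADIENT member of (3.42)), Thm 3.11 p. 416, Thm 3.13 p. 426; [Balaban1985Variational] (45) p. 285, (103) p. 293,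
# (110)–(111) p. 294, (117) p. 295: **THE SLICE-GRADIENT ROW OF `H̃_k = G̃_kQ_k†(Q_kG̃_kQ_k†)⁻¹` (coarse bonds → fine bonds) ON THE CELL's MODEL, ∃-FIRST,
# HEIGHT-FREE** — (K67) `B9Eq3126H1kSliceGradRowClosed` (the slice-gradient row of `H₁,k = G₁,kQ_k†(Q_kG₁,kQ_k†)⁻¹`) RE-RUN AT PRINT's `G̃_k = Δ̃_{a,k}⁻¹`:
# (K63)'s `local_letter_H1_of_letters` at the three letters (L)(∇_μ∘G̃_k) = the NE9 owner's (T4B) `B9Eq3130GtildeGradRowClosed.exists_local_rows_G1kPi`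
# conjunct 3 (output blocks `Π∘btgt`, re-based at `Π∘bpos` at the price `e^{κ}`; its window `‖J‖ ≤ α` served at the enlarged radius `max(α, j₀)` exactly as
# (K85) serves (T4E)), (L)(Q_k†) = (K81)'s station ((SBLT) size + range `1`, `letter_of_range`), (L)(K̃) = (K80) `exists_local_letter_KinvLatticeKPi`;
# `(∇_μ∘G̃_k)∘Q_k†∘K̃ = ∇_μ∘H̃_k` by `H1LatticeK_eq`; the `∇_U` member by the owner's (VGT-a) `norm_covGrad_apply_le_of_slice`

statement-level skeleton of published theorems with citation tags; proofs where landed; nothing here is a claim about the Yang–Mills mass gap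

CITATION HEADER (lean-in-tree rule).  Audit cell `pub-balaban`, sub-cell `t4`, BINDER row NE9; NE9 crux-team LEAF PROVER 01 (`b2b-balaban-t4-ne9-formalise-leaf-01`, gen 91;
(J-1); bears_on: R4/N22).  The GRADIENT half of the NE9 owner's RULING R-ne9p1-g97-4 (2)(b) (journal `HOME/CLAIMS.log` l.66556; memo
`t4/b2b-balaban-t4-ne9-p1/g97/PLAN-V16-SEED.md` §2 (b), §6) — the VALUE half is ne9-leaf-05 g88's (K80)∕(K81)∕(K82).  Composed BY NAME, nothing restated: (T4B)
`exists_local_rows_G1kPi` (t4-ne9-p1 g97), (K80) `exists_local_letter_KinvLatticeKPi` (ne9-leaf-05 g88), (K63) `B9Eq3126H1SupRowOfLetters.letter_of_range` ∕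
`local_letter_H1_of_letters`, ne9-leaf-03's (SBLT) `B9Eq315QkSingleBondLetter.norm_adjoint_QkW_apply_le_local_sharp`, `B9Eq349BlockDistanceWeight.tdist_shift_le_one`,
`B9Eq33CovDerivLocalLetterTower.tdist_bigBlock_bpos_btgt_le_one`, `B11Eq103H1Complex.H1LatticeK_eq`, the owner's (VGT-a) `B9Eq326LocalPartTowerSliceGradientRow.norm_covGrad_apply_le_of_slice`
and (E2)'s slice device (`covDerivL2K ∘ₗ WL2.linearEquiv.symm ∘ₗ LinearMap.funLeft ∘ₗ WL2.linearEquiv`, an `⟨_, rfl⟩` continuous linear map — no definition), `B4Sect5Torus.torusSum_le`.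
Sources read through the audited headers of (K67), (K81), (T4B) (`paper:balaban1985-cmp99-background-propagators`, journal page = PDF page + 388: p. 391 (3.3), p. 397 (3.42),
p. 399 Thm 3.3, p. 420 (3.126), p. 422 (3.132)–(3.133), p. 426 Thm 3.13).  NOTHING of print's proof is reproduced; no constant of print is valued.

WHAT IS PROVED (sorry-free; proof lane — no `def`; [folklore] composition BY NAME).
* **`exists_local_gradLetter_H1LatticeKPi`** — `∃ α₁ j₁ B δ` (`0 < α₁`, `0 < j₁`, `0 ≤ B`, `0 < δ`) BEFORE (K81)'s binder block VERBATIM, then `(μ : Fin d) (b)`: for every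
  coarse-bond field `z` supported over the bonds based at `v` with `‖z(b′)‖ ≤ F`, every component `μ` and fine bond `b`:
  `‖(D_U(H̃_kz)_μ)(b)‖ ≤ B·e^{−δ·d_m(Π(b₋), v)}·F` and `‖(∇_UH̃_kz)(b, μ)‖ ≤ B·e^{−δ·d_m(Π(b₋), v)}·F`, `H̃_k = B11Eq103H1Complex.H1LatticeK hposπ hQ`.
  Rates: `κ := min(δ_D, δ_K)` ((T4B)'s and (K80)'s), `δ := κ∕2`; radii `α₁ := min(α_D, α_K)`, `j₁ := min(α_D, j_K)` (the owner's block has the single window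
  `‖J‖ ≤ α`, read here at `max(α, j₀) ≤ α_D`); `B = B_K·(M_Q†e^{κ})·K·(B_De^{κ})·K`, `K = K_d(κ∕2)`, `M_Q† = M_φ′e^{100d(d+1)L^dA_Q}M_φ·2d`.
HONEST SCOPE.  The gradient companion of (K81) (value row); consumer: the gradient rows of the middle word `H̃_kQ_kG̃_k` of `𝔊̃_k` (J-2).  A theorem about the
cell's MODEL; `hpos′`, `hpos`, `hposπ`, `hQ`, the windows, the level data, `c₀ = η^d`, `‖J‖ ≤ j₀` stay HYPOTHESES; constants crude; nothing of [B9] Thm 3.1 ∕ 3.3 ∕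
3.11 ∕ 3.13 or [B11] (117) asserted, valued or discharged; «NE9 ⇐ the named binders»; NE9 NOT PRINTED ∕ NOT PROVED; row WALLED ON A MODEL (O-NE9-1; #5 UNRULED); spine
PROVED 0∕9; rung (B)+1 on a finite T⁴ — NOT infinite volume, NOT mass gap, NOT BetaPertH, NOT Clay.  HONEST DEPENDENCY: continuum YM on T⁴ ⇐ BetaPertH ∧ nine spine
estimates (0/9 proved); BetaPertH ⇐ (D1) ∧ (D4) ∧ CAP+tail; G-an2-4 gates asym, D1 and NE2/3/4.  NEW file importing (K81) and (T4B); nothing modified.  Net new unproved facts: 0.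
-/

noncomputable section

set_option autoImplicit false

open scoped InnerProductSpace ComplexConjugate BigOperators

namespace Literature.MathematicalPhysics.QuantumFieldTheory.Balaban1983to89.B9Eq3126H1kPiSliceGradRowClosed

open B4Sect5Torus (TSite tdist tdist_nonneg tdist_symm tdist_self tdist_triangle torusSum_le)
open B4Sect5Proof (latticeConst latticeConst_nonneg)
open B9SectCLatticeCarrier (Bond DirPair bpos btgt shift unshift)
open B9Eq311L2Pairing (WL2)
open B9Eq319QprimeTorus (fineP blockCoord)
open B7Prop1Explicit (U1 Wcx boxVec)
open B11Eq103H1Complex (SiteL2K BondL2K covDerivL2K covDivL2K G1LatticeK KinvLatticeK H1LatticeK H1LatticeK_eq)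
open B9Eq33CovDerivVector (covGrad)
open B9Eq310DeltaPrime (plaqHolU)
open B9Eq310HessianOperator (adTransportW)
open B9Eq315QTorus (perCfg cornerSite)
open B9Eq315QTower (towerP UlevOf)
open B9Eq316TowerFlatIsOneStep (towerP_eq_fineP_pow siteCast)
open B9Eq326OperatorTower (QkW laplaceAk)
open B9Eq324DeltaPrimeATower (laplacePrimeAk)
open B9Eq33CovDerivLocalLetterTower (tdist_bigBlock_bpos_btgt_le_one)
open B9Eq3130GtildeGradRowClosed (exists_local_rows_G1kPi)
open B9Eq3132QGtildeQInvLetterClosed (exists_local_letter_KinvLatticeKPi)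
open B9Eq3119DeltaPiTower (laplaceAkPi)
open B9Eq326LocalPartTowerSliceGradientRow (norm_covGrad_apply_le_of_slice)
open B9Eq3126H1SupRowOfLetters (letter_of_range local_letter_H1_of_letters)
open B9Eq349BlockDistanceWeight (tdist_shift_le_one)
open B9Eq315QkSingleBondLetter (norm_adjoint_QkW_apply_le_local_sharp)

variable {d : ℕ} (hd : 1 ≤ d) (L : ℕ) [NeZero L] (hL : 1 ≤ L) (hL3 : 3 ≤ L)
  {𝔸 : Type*} [NormedRing 𝔸] [NormedAlgebra ℂ 𝔸] [CompleteSpace 𝔸] [NormOneClass 𝔸] [StarRing 𝔸] [NormedStarGroup 𝔸] [StarModule ℂ 𝔸]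
  {W : Type*} [NormedAddCommGroup W] [InnerProductSpace ℂ W] [FiniteDimensional ℂ W] (φ : W ≃ₗ[ℂ] 𝔸)
  {Mφ Mφ' : ℝ} (hMφ : 0 ≤ Mφ) (hMφ' : 0 ≤ Mφ') (hφ : ∀ w, ‖φ w‖ ≤ Mφ * ‖w‖) (hφ' : ∀ X, ‖φ.symm X‖ ≤ Mφ' * ‖X‖) (hstar : ∀ X : 𝔸, ‖star X‖ ≤ ‖X‖)
  {a : ℝ} (ha : 0 < a) {a' : ℝ} (ha' : 0 < a') {ϱ : ℝ} (hϱ0 : 0 ≤ ϱ) (hϱ1 : ϱ < 1)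
  (τ : 𝔸 →ₗ[ℂ] ℂ) {Cτ : ℝ} (hτ : ∀ X, ‖τ X‖ ≤ Cτ * ‖X‖) (hCτ : 0 ≤ Cτ) {Mτ : ℝ} (hτm : ∀ X Y : 𝔸, ‖τ (X * Y)‖ ≤ Mτ * ‖X‖ * ‖Y‖) (hMτ : 0 ≤ Mτ)
  {ρw : ℝ} (hρw : 0 ≤ ρw)
  (hτ₁ : ∀ X : 𝔸, τ (star X) = conj (τ X)) (hτ₂ : ∀ X Y : 𝔸, τ (X * Y) = τ (Y * X)) (hφτ : ∀ X Y : 𝔸, ⟪φ.symm X, φ.symm Y⟫_ℂ = τ (star X * Y))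
  (AQ : ℝ)

omit [NeZero L] in
/-- `e^{−r t} ≤ e^{−κ t}` for `κ ≤ r`, `0 ≤ t`. [folklore] -/
private theorem exp_weaken' {r κ t : ℝ} (hκ : κ ≤ r) (ht : 0 ≤ t) : Real.exp (-(r * t)) ≤ Real.exp (-(κ * t)) :=
  Real.exp_le_exp.2 (by nlinarith)

set_option maxHeartbeats 400000 in -- margin only, as (K81): the ≈ 50-binder supplier block at two radii
include hd hL hL3 hMφ hMφ' hφ hφ' hstar ha ha' hϱ0 hϱ1 hτ hCτ hτm hMτ hρw hτ₁ hτ₂ hφτ in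
/-- **THE SLICE-GRADIENT ROW OF `H̃_k = G̃_kQ_k†(Q_kG̃_kQ_k†)⁻¹` ON THE CELL's MODEL, ∃-FIRST.**  (K63) `local_letter_H1_of_letters` at the three letters
(L)(∇_μ∘G̃_k; B_De^{κ}, κ) ((T4B) `exists_local_rows_G1kPi` conjunct 3 — (E2)'s slice device post-composed with `G̃_k = G1LatticeK hposπ` —, output `Π∘btgt`
re-based at `Π∘bpos` by `tdist_bigBlock_bpos_btgt_le_one`, the owner's window `‖J‖ ≤ α` served at the radius `max(α, j₀)`), (L)(Q_k†; M_Q†e^{κ}, κ)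
(`norm_adjoint_QkW_apply_le_local_sharp`, range `1`, `letter_of_range`), (L)(K̃; B_K, κ) ((K80)); `κ = min(δ_D, δ_K)`, one rate loss (`δ = κ∕2`);
`(∇_μ∘G̃_k)∘Q_k†∘K̃ = ∇_μ∘H̃_k` by `H1LatticeK_eq`; the `∇_U` member by `norm_covGrad_apply_le_of_slice`.
[cite: Balaban1985BackgroundPropagators, (3.126) p.420, (3.132)–(3.133) p.422, (3.3) p.391, Thm 3.3 p.399, Thm 3.11 p.416, Thm 3.13 p.426]
[cite: Balaban1985Variational, (45) p.285, (103) p.293, (117) p.295] -/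
theorem exists_local_gradLetter_H1LatticeKPi :
    ∃ α₁ j₁ B δ : ℝ, 0 < α₁ ∧ 0 < j₁ ∧ 0 ≤ B ∧ 0 < δ ∧
      ∀ (n : ℕ) (η : ℝ) (_hηL : η * (L : ℝ) ^ (n + 1) = 1) (c₀ c₁ : ℝ) [Fact (0 < c₀)] [Fact (0 < c₁)]
        (_hw : c₀ * ((L : ℝ) ^ (n + 1)) ^ d = c₁) (_hρ : |η| ^ d / c₀ ≤ ρw) (m : Fin d → ℕ) [∀ i, NeZero (m i)] (_hm : ∀ i, 1 ≤ m i)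
        (U : Bond d (towerP L m (n + 1)) → 𝔸ˣ) (αU : ℕ → ℝ) (_hα0 : ∀ j, 0 ≤ αU j) (hα1 : ∀ j, αU j ≤ 1 / 64)
        (hαL : ∀ j, 50 * (d + 1) * αU j * (L : ℝ) ^ d ≤ 1 / 2)
        (hU1 : ∀ (j : ℕ) (x : B7Prop1Explicit.Site d) (k : Fin d), perCfg (towerP L m (j + 1)) (UlevOf L m (n + 1) U j) x k ∈ U1 𝔸)
        (hreg : ∀ (j : ℕ) (y : TSite d (towerP L m j)) (k : Fin d) (ρ' : Fin d → Fin L),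
          ‖((Wcx L (perCfg (towerP L m (j + 1)) (UlevOf L m (n + 1) U j)) (cornerSite L y) k (boxVec L ρ') : 𝔸ˣ) : 𝔸) - 1‖ ≤ αU j)
        (εU : ℕ → ℝ) (_hεU : ∀ j, 0 ≤ εU j) (_hUε : ∀ (j : ℕ) (b : Bond d (towerP L m (j + 1))), ‖(UlevOf L m (n + 1) U j b : 𝔸) - 1‖ ≤ εU j)
        (_hLb : ∀ (j : ℕ) (b : Bond d (towerP L m (j + 1))), UlevOf L m (n + 1) U j b ∈ U1 𝔸)
        (α : ℝ) (_hα : 0 ≤ α) (_hαle : α ≤ α₁)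
        (hUst : ∀ b, star (U b : 𝔸) = (((U b)⁻¹ : 𝔸ˣ) : 𝔸)) (_hUb : ∀ b, U b ∈ U1 𝔸) (_hUη : ∀ b, ‖(U b : 𝔸) - 1‖ ≤ α * η)
        (_hpl : ∀ p : B9SectCLatticeCarrier.Plaq d (towerP L m (n + 1)), ‖(plaqHolU U p : 𝔸) - 1‖ ≤ α * η ^ 2)
        (_hUgrad : ∀ (x : TSite d (towerP L m (n + 1))) (μ : Fin d), ‖(U (x, μ) : 𝔸) - U (unshift μ x, μ)‖ ≤ α * η ^ 2)
        (_hRlev : ∀ (j : ℕ) (b : Bond d (towerP L m (j + 1))) (w : W), ‖adTransportW φ (UlevOf L m (n + 1) U j) b w‖ ≤ ‖w‖)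
        (_hεg : ∀ j < n + 1, εU j ≤ α * ϱ ^ j) (_hAQ : ∑ j ∈ Finset.range (n + 1), αU j ≤ AQ)
        (hpos' : ∀ x : SiteL2K ℂ d (towerP L m (n + 1)) c₀ W, x ≠ 0 → 0 < RCLike.re ⟪x, laplacePrimeAk L m n φ η U a' (c₁ := c₁) x⟫_ℂ)
        (hpos : ∀ x : BondL2K ℂ d (towerP L m (n + 1)) c₀ W, x ≠ 0 →
          0 < RCLike.re ⟪x, laplaceAk L m n φ η U hL αU hα1 hU1 hreg τ (c₀ := c₀) (c₁ := c₁) a x⟫_ℂ)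
        (_hc₀η : c₀ = η ^ d) (j₀ : ℝ) (_hJ : ∀ μ y, ‖B9Eq39Adjoint.J (fun μ => B9Eq33CovDerivVector.shiftEquiv μ) (fun μ y => U (y, μ)) η μ y‖ ≤ j₀) (_hj : j₀ ≤ j₁)
        (hposπ : ∀ x : BondL2K ℂ d (towerP L m (n + 1)) c₀ W, x ≠ 0 →
          0 < RCLike.re ⟪x, laplaceAkPi L m n φ τ η U a' hpos' hL αU hα1 hU1 hreg (c₁ := c₁) a x⟫_ℂ)
        (hQ : Function.Surjective (QkW L m n φ U hL αU hα1 hU1 hreg (c₀ := c₀) (c₁ := c₁)))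
        (v : TSite d m) (z : BondL2K ℂ d m c₁ W) (F : ℝ)
        (_hzv : ∀ b', bpos b' ≠ v → WL2.equiv ℂ (fun _ : Bond d m => c₁) W z b' = 0)
        (_hzF : ∀ b', ‖WL2.equiv ℂ (fun _ : Bond d m => c₁) W z b'‖ ≤ F) (μ : Fin d) (b : Bond d (towerP L m (n + 1))),
        ‖WL2.equiv ℂ (fun _ : Bond d (towerP L m (n + 1)) => c₀) W (covDerivL2K ℂ c₀ ((η : ℂ))⁻¹ (adTransportW φ U)
            ((WL2.equiv ℂ (fun _ : TSite d (towerP L m (n + 1)) => c₀) W).symm fun y =>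
              WL2.equiv ℂ (fun _ : Bond d (towerP L m (n + 1)) => c₀) W (H1LatticeK hposπ hQ z) (y, μ))) b‖ ≤
          B * Real.exp (-(δ * tdist m (blockCoord (L ^ (n + 1)) m (siteCast (towerP_eq_fineP_pow L m (n + 1)) (bpos b))) v)) * F ∧
        ‖covGrad ((η : ℂ))⁻¹ (adTransportW φ U)
            (WL2.equiv ℂ (fun _ : Bond d (towerP L m (n + 1)) => c₀) W (H1LatticeK hposπ hQ z)) (b, μ)‖ ≤
          B * Real.exp (-(δ * tdist m (blockCoord (L ^ (n + 1)) m (siteCast (towerP_eq_fineP_pow L m (n + 1)) (bpos b))) v)) * F := by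
  classical
  obtain ⟨αD, BD, δD, hαD, hBD, hδD, HD⟩ :=
    exists_local_rows_G1kPi hd L hL hL3 φ hMφ hMφ' hφ hφ' hstar ha ha' hϱ0 hϱ1 τ hτ hCτ hτm hMτ hρw hτ₁ hτ₂ hφτ AQ
  obtain ⟨αK, jK, BK, δK, hαK, hjK, hBK, hδK, HKi⟩ :=
    exists_local_letter_KinvLatticeKPi hd L hL hL3 φ hMφ hMφ' hφ hφ' hstar ha ha' hϱ0 hϱ1 τ hτ hCτ hτm hMτ hρw hτ₁ hτ₂ hφτ AQ
  obtain ⟨κ, hκdef⟩ : ∃ κ : ℝ, κ = min δD δK := ⟨_, rfl⟩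
  have hκ0 : 0 < κ := by rw [hκdef]; exact lt_min hδD hδK
  have hκD : κ ≤ δD := by rw [hκdef]; exact min_le_left _ _
  have hκK : κ ≤ δK := by rw [hκdef]; exact min_le_right _ _
  obtain ⟨K, hKdef⟩ : ∃ K : ℝ, K = latticeConst d (κ - κ / 2) := ⟨_, rfl⟩
  have hK0 : 0 ≤ K := by rw [hKdef]; exact latticeConst_nonneg d (sub_pos.2 (half_lt_self hκ0)).le
  obtain ⟨MQa, hMQa⟩ : ∃ M : ℝ, M = Mφ' * Real.exp (100 * d * (d + 1) * (L : ℝ) ^ d * AQ) * Mφ * ((2 * d : ℕ) : ℝ) := ⟨_, rfl⟩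
  have hMQa0 : 0 ≤ MQa := by rw [hMQa]; positivity
  obtain ⟨Bs, hBs⟩ : ∃ B : ℝ, B = BK * (MQa * Real.exp (κ * 1)) * K * (BD * Real.exp (κ * 1)) * K := ⟨_, rfl⟩
  have hBs0 : 0 ≤ Bs := by rw [hBs]; positivity
  refine ⟨min αD αK, min αD jK, Bs, κ / 2, lt_min hαD hαK, lt_min hαD hjK, hBs0, half_pos hκ0, ?_⟩
  intro n η hηL c₀ c₁ _ _ hw hρ m _ hm U αU hα0 hα1 hαL hU1 hreg εU hεU hUε hLb α hα hαle hUst hUb hUη hpl hUgrad hRlev hεg hAQ hpos' hpos hc₀η j₀ hJ hj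
    hposπ hQ v z F hzv hzF μ b
  have hc₀ : (0 : ℝ) < c₀ := Fact.out
  haveI : Nonempty (Bond d m) := ⟨(v, ⟨0, hd⟩)⟩
  have b' : Bond d m := (v, ⟨0, hd⟩)
  have hF0 : 0 ≤ F := (norm_nonneg _).trans (hzF (v, ⟨0, hd⟩))
  have hη : 0 < η := by
    have hLp : (0 : ℝ) < (L : ℝ) ^ (n + 1) := pow_pos (Nat.cast_pos.2 hL) _
    by_contra h
    have : η * (L : ℝ) ^ (n + 1) ≤ 0 := mul_nonpos_of_nonpos_of_nonneg (not_lt.mp h) hLp.le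
    linarith only [this, hηL]
  have hj₀0 : 0 ≤ j₀ := (norm_nonneg _).trans (hJ b.2 b.1)
  have hαK_ : α ≤ αK := hαle.trans (min_le_right _ _)
  have hjK_ : j₀ ≤ jK := hj.trans (min_le_right _ _)
  -- the owner's window at the enlarged radius `α′ = max α j₀ ≤ α_D`
  have hα'0 : 0 ≤ max α j₀ := hα.trans (le_max_left _ _)
  have hα'D : max α j₀ ≤ αD := max_le (hαle.trans (min_le_left _ _)) (hj.trans (min_le_left _ _))
  have hUη' : ∀ bb, ‖(U bb : 𝔸) - 1‖ ≤ max α j₀ * η := fun bb => (hUη bb).trans (mul_le_mul_of_nonneg_right (le_max_left _ _) hη.le)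
  have hpl' : ∀ p : B9SectCLatticeCarrier.Plaq d (towerP L m (n + 1)), ‖(plaqHolU U p : 𝔸) - 1‖ ≤ max α j₀ * η ^ 2 := fun p =>
    (hpl p).trans (mul_le_mul_of_nonneg_right (le_max_left _ _) (sq_nonneg η))
  have hUgrad' : ∀ (x : TSite d (towerP L m (n + 1))) (μ : Fin d), ‖(U (x, μ) : 𝔸) - U (unshift μ x, μ)‖ ≤ max α j₀ * η ^ 2 := fun x μ =>
    (hUgrad x μ).trans (mul_le_mul_of_nonneg_right (le_max_left _ _) (sq_nonneg η))
  have hεg' : ∀ j < n + 1, εU j ≤ max α j₀ * ϱ ^ j := fun j hjn => (hεg j hjn).trans (mul_le_mul_of_nonneg_right (le_max_left _ _) (pow_nonneg hϱ0 j))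
  have hJ' : ∀ (μ : Fin d) (y : TSite d (towerP L m (n + 1))),
      ‖B9Eq39Adjoint.J (fun μ => B9Eq33CovDerivVector.shiftEquiv μ) (fun μ y => U (y, μ)) η μ y‖ ≤ max α j₀ := fun μ y => (hJ μ y).trans (le_max_right _ _)
  -- the four CLMs
  obtain ⟨Gtcl, hGtcl⟩ : ∃ T : BondL2K ℂ d (towerP L m (n + 1)) c₀ W →L[ℂ] BondL2K ℂ d (towerP L m (n + 1)) c₀ W,
      T = LinearMap.toContinuousLinearMap (G1LatticeK hposπ) := ⟨_, rfl⟩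
  obtain ⟨Qacl, hQacl⟩ : ∃ T : BondL2K ℂ d m c₁ W →L[ℂ] BondL2K ℂ d (towerP L m (n + 1)) c₀ W,
      T = LinearMap.toContinuousLinearMap (LinearMap.adjoint (QkW L m n φ U hL αU hα1 hU1 hreg (c₀ := c₀) (c₁ := c₁))) := ⟨_, rfl⟩
  obtain ⟨Kpcl, hKpcl⟩ : ∃ T : BondL2K ℂ d m c₁ W →L[ℂ] BondL2K ℂ d m c₁ W, T = LinearMap.toContinuousLinearMap (KinvLatticeK hposπ hQ) := ⟨_, rfl⟩
  obtain ⟨Dcl, hDcl⟩ : ∃ T : BondL2K ℂ d (towerP L m (n + 1)) c₀ W →L[ℂ] BondL2K ℂ d (towerP L m (n + 1)) c₀ W,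
      ∀ (u : BondL2K ℂ d (towerP L m (n + 1)) c₀ W) (b' : Bond d (towerP L m (n + 1))),
        WL2.equiv ℂ (fun _ : Bond d (towerP L m (n + 1)) => c₀) W (T u) b' =
          WL2.equiv ℂ (fun _ : Bond d (towerP L m (n + 1)) => c₀) W (covDerivL2K ℂ c₀ ((η : ℂ))⁻¹ (adTransportW φ U)
            ((WL2.equiv ℂ (fun _ : TSite d (towerP L m (n + 1)) => c₀) W).symm fun y =>
              WL2.equiv ℂ (fun _ : Bond d (towerP L m (n + 1)) => c₀) W u (y, μ))) b' :=
    ⟨LinearMap.toContinuousLinearMap (covDerivL2K ℂ c₀ ((η : ℂ))⁻¹ (adTransportW φ U) ∘ₗ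
        (WL2.linearEquiv ℂ ℂ (fun _ : TSite d (towerP L m (n + 1)) => c₀)).symm.toLinearMap ∘ₗ
        LinearMap.funLeft ℂ W (fun y : TSite d (towerP L m (n + 1)) => ((y, μ) : Bond d (towerP L m (n + 1)))) ∘ₗ
        (WL2.linearEquiv ℂ ℂ (fun _ : Bond d (towerP L m (n + 1)) => c₀)).toLinearMap), fun _ _ => rfl⟩
  -- (L)(∇_μ∘G̃_k; B_D·e^κ, κ), re-based at `Π∘bpos`
  have hG : ∀ (v : TSite d m) (f : BondL2K ℂ d (towerP L m (n + 1)) c₀ W) (F : ℝ),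
      (∀ x, blockCoord (L ^ (n + 1)) m (siteCast (towerP_eq_fineP_pow L m (n + 1)) (bpos x)) ≠ v → WL2.equiv ℂ (fun _ : Bond d (towerP L m (n + 1)) => c₀) W f x = 0) →
      (∀ x, ‖WL2.equiv ℂ (fun _ : Bond d (towerP L m (n + 1)) => c₀) W f x‖ ≤ F) →
      ∀ x, ‖WL2.equiv ℂ (fun _ : Bond d (towerP L m (n + 1)) => c₀) W ((Dcl ∘L Gtcl) f) x‖ ≤
        (BD * Real.exp (κ * 1)) * Real.exp (-(κ * tdist m (blockCoord (L ^ (n + 1)) m (siteCast (towerP_eq_fineP_pow L m (n + 1)) (bpos x))) v)) * F := by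
    intro v f F hfv hfF x
    have hF : 0 ≤ F := (norm_nonneg _).trans (hfF x)
    have h := (HD n η hηL c₀ c₁ hw hρ m hm U αU hα0 hα1 hU1 hreg εU hεU hUε hLb (max α j₀) hα'0 hα'D hUst hUb hUη' hpl' hUgrad' hRlev hεg' hAQ
      hpos' hpos hposπ hc₀η hJ' v f F hfv hfF μ x (bpos x)).2.2.1
    rw [ContinuousLinearMap.comp_apply, hDcl, hGtcl, LinearMap.coe_toContinuousLinearMap']
    have hone := tdist_bigBlock_bpos_btgt_le_one (L := L) (m := m) (k := n + 1) hm x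
    have htri := tdist_triangle hm (blockCoord (L ^ (n + 1)) m (siteCast (towerP_eq_fineP_pow L m (n + 1)) (bpos x)))
      (blockCoord (L ^ (n + 1)) m (siteCast (towerP_eq_fineP_pow L m (n + 1)) (btgt x))) v
    have hexp : Real.exp (-(δD * tdist m (blockCoord (L ^ (n + 1)) m (siteCast (towerP_eq_fineP_pow L m (n + 1)) (btgt x))) v)) ≤
        Real.exp (κ * 1) * Real.exp (-(κ * tdist m (blockCoord (L ^ (n + 1)) m (siteCast (towerP_eq_fineP_pow L m (n + 1)) (bpos x))) v)) := by
      rw [← Real.exp_add]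
      exact Real.exp_le_exp.2 (by nlinarith [hκ0.le, hκD, tdist_nonneg m (blockCoord (L ^ (n + 1)) m (siteCast (towerP_eq_fineP_pow L m (n + 1)) (btgt x))) v])
    calc _ ≤ BD * Real.exp (-(δD * tdist m (blockCoord (L ^ (n + 1)) m (siteCast (towerP_eq_fineP_pow L m (n + 1)) (btgt x))) v)) * F := h
      _ ≤ BD * (Real.exp (κ * 1) * Real.exp (-(κ * tdist m (blockCoord (L ^ (n + 1)) m (siteCast (towerP_eq_fineP_pow L m (n + 1)) (bpos x))) v))) * F :=
          mul_le_mul_of_nonneg_right (mul_le_mul_of_nonneg_left hexp hBD) hF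
      _ = _ := by ring
  -- (L)(K̃; B_K, κ)
  have hK : ∀ (v : TSite d m) (z : BondL2K ℂ d m c₁ W) (F : ℝ), (∀ x, bpos x ≠ v → WL2.equiv ℂ (fun _ : Bond d m => c₁) W z x = 0) →
      (∀ x, ‖WL2.equiv ℂ (fun _ : Bond d m => c₁) W z x‖ ≤ F) →
      ∀ x, ‖WL2.equiv ℂ (fun _ : Bond d m => c₁) W (Kpcl z) x‖ ≤ BK * Real.exp (-(κ * tdist m (bpos x) v)) * F := by
    intro v z F hzv hzF x
    have hF : 0 ≤ F := (norm_nonneg _).trans (hzF x)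
    rw [hKpcl, LinearMap.coe_toContinuousLinearMap']
    exact (HKi n η hηL c₀ c₁ hw hρ m hm U αU hα0 hα1 hαL hU1 hreg εU hεU hUε hLb α hα hαK_ hUst hUb hUη hpl hUgrad hRlev hεg hAQ hpos' hpos hc₀η j₀ hJ hjK_
      hposπ hQ v z F hzv hzF x).trans
      (mul_le_mul_of_nonneg_right (mul_le_mul_of_nonneg_left (exp_weaken' hκK (tdist_nonneg m _ _)) hBK) hF)
  -- (L)(Q_k†; M_Q†·e^κ, κ): size from the single-bond letter, range `1`
  have hdiag : c₁ / c₀ * (Mφ' * ((((L : ℝ) ^ (n + 1)) ^ d)⁻¹ * Real.exp (100 * d * (d + 1) * (L : ℝ) ^ d * AQ)) * Mφ) * ((2 * d : ℕ) : ℝ) = MQa := by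
    have hLp : (0 : ℝ) < ((L : ℝ) ^ (n + 1)) ^ d := pow_pos (pow_pos (Nat.cast_pos.2 hL) _) _
    rw [hMQa, ← hw]
    field_simp
  have hQaM : ∀ (z : BondL2K ℂ d m c₁ W) (F : ℝ), (∀ x, ‖WL2.equiv ℂ (fun _ : Bond d m => c₁) W z x‖ ≤ F) →
      ∀ x, ‖WL2.equiv ℂ (fun _ : Bond d (towerP L m (n + 1)) => c₀) W (Qacl z) x‖ ≤ MQa * F := by
    intro z F hzF x
    have hF : 0 ≤ F := (norm_nonneg _).trans (hzF b')
    have h := norm_adjoint_QkW_apply_le_local_sharp L m n φ (c₀ := c₀) U hL αU hα0 hα1 hU1 hreg hMφ hφ hMφ' hφ' hAQ z x hF (fun c _ => hzF c)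
    rw [hQacl, LinearMap.coe_toContinuousLinearMap', ← hdiag]
    exact h
  have hQaρ : ∀ (v : TSite d m) (z : BondL2K ℂ d m c₁ W), (∀ x, bpos x ≠ v → WL2.equiv ℂ (fun _ : Bond d m => c₁) W z x = 0) →
      ∀ x, (1 : ℝ) < tdist m (blockCoord (L ^ (n + 1)) m (siteCast (towerP_eq_fineP_pow L m (n + 1)) (bpos x))) v →
        WL2.equiv ℂ (fun _ : Bond d (towerP L m (n + 1)) => c₀) W (Qacl z) x = 0 := by
    intro v z hzv x hx
    have hnear : ∀ c : Bond d m, (blockCoord (L ^ (n + 1)) m (siteCast (towerP_eq_fineP_pow L m (n + 1)) x.1) = c.1 ∨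
        blockCoord (L ^ (n + 1)) m (siteCast (towerP_eq_fineP_pow L m (n + 1)) x.1) = shift c.2 c.1) →
        ‖WL2.equiv ℂ (fun _ : Bond d m => c₁) W z c‖ ≤ 0 := by
      intro c hc
      have hcv : bpos c ≠ v := by
        intro hcv
        rcases hc with h1 | h2
        · have : tdist m (blockCoord (L ^ (n + 1)) m (siteCast (towerP_eq_fineP_pow L m (n + 1)) (bpos x))) v = 0 := by
            rw [show bpos x = x.1 from rfl, h1, show c.1 = bpos c from rfl, hcv, tdist_self]
          linarith only [this, hx]
        · have : tdist m (blockCoord (L ^ (n + 1)) m (siteCast (towerP_eq_fineP_pow L m (n + 1)) (bpos x))) v ≤ 1 := by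
            rw [show bpos x = x.1 from rfl, h2, show c.1 = bpos c from rfl, hcv, tdist_symm hm]
            exact tdist_shift_le_one hm v c.2
          linarith only [this, hx]
      rw [hzv c hcv, norm_zero]
    have h := norm_adjoint_QkW_apply_le_local_sharp L m n φ (c₀ := c₀) U hL αU hα0 hα1 hU1 hreg hMφ hφ hMφ' hφ' hAQ z x le_rfl hnear
    rw [mul_zero] at h
    rw [hQacl, LinearMap.coe_toContinuousLinearMap']
    exact norm_le_zero_iff.1 h
  have hQa := letter_of_range (tdist m) (fun c : Bond d m => bpos c) (fun x : Bond d (towerP L m (n + 1)) => blockCoord (L ^ (n + 1)) m (siteCast (towerP_eq_fineP_pow L m (n + 1)) (bpos x))) Qacl (M := MQa) (ρ := 1)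
    (κ := κ) hκ0.le hQaM hQaρ
  -- (K63)'s assembly, one rate loss
  have hS : ∀ w' : TSite d m, ∑ u : TSite d m, Real.exp (-((κ - κ / 2) * tdist m w' u)) ≤ K := fun w' => by
    rw [hKdef]; exact torusSum_le d hm (sub_pos.2 (half_lt_self hκ0)) w'
  have h := local_letter_H1_of_letters (fun x : Bond d (towerP L m (n + 1)) => blockCoord (L ^ (n + 1)) m (siteCast (towerP_eq_fineP_pow L m (n + 1)) (bpos x))) (fun c : Bond d m => bpos c) (tdist m)
    (tdist_nonneg m) (fun u y w' => tdist_triangle hm u y w') (Dcl ∘L Gtcl) Qacl Kpcl (by positivity : (0 : ℝ) ≤ BD * Real.exp (κ * 1))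
    (mul_nonneg hMQa0 (Real.exp_nonneg _)) hBK (half_pos hκ0).le (half_le_self hκ0.le) hG hQa hK hS v z F hzv hzF b
  have e : ((Dcl ∘L Gtcl) ∘L Qacl ∘L Kpcl) z = Dcl (H1LatticeK hposπ hQ z) := by
    have e₀ : (Gtcl ∘L Qacl ∘L Kpcl) z = H1LatticeK hposπ hQ z := by
      rw [hGtcl, hQacl, hKpcl, H1LatticeK_eq]; rfl
    rw [← e₀]
    rfl
  rw [e, hDcl] at h
  have h' : ‖WL2.equiv ℂ (fun _ : Bond d (towerP L m (n + 1)) => c₀) W (covDerivL2K ℂ c₀ ((η : ℂ))⁻¹ (adTransportW φ U)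
      ((WL2.equiv ℂ (fun _ : TSite d (towerP L m (n + 1)) => c₀) W).symm fun y =>
        WL2.equiv ℂ (fun _ : Bond d (towerP L m (n + 1)) => c₀) W (H1LatticeK hposπ hQ z) (y, μ))) b‖ ≤
      Bs * Real.exp (-(κ / 2 * tdist m (blockCoord (L ^ (n + 1)) m (siteCast (towerP_eq_fineP_pow L m (n + 1)) (bpos b))) v)) * F := by
    refine h.trans (le_of_eq ?_)
    rw [hBs]
  exact ⟨h', norm_covGrad_apply_le_of_slice _ _ _ b μ h'⟩

end Literature.MathematicalPhysics.QuantumFieldTheory.Balaban1983to89.B9Eq3126H1kPiSliceGradRowClosed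

end
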